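import Summits.NavierStokesRegularity.NavierStokesRegularity.Theses.RellichScar
import Summits.NavierStokesRegularity.NavierStokesRegularity.Theorems.SymmetricScarExists.Negative.SpiralWorld
import Summits.NavierStokesRegularity.NavierStokesRegularity.Theorems.SymmetricScarExists.Negative.RdssWall
import Summits.NavierStokesRegularity.NavierStokesRegularity.Theorems.ScarRigidity.Negative.LogicAndLoadBearing
import Summits.NavierStokesRegularity.NavierStokesRegularity.Theorems.RellichScarScarRigidityApexMild
import Summits.NavierStokesRegularity.NavierStokesRegularity.Theorems.RellichScarSymmetricScarExistsApexScarTrace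
import Summits.NavierStokesRegularity.NavierStokesRegularity.Theorems.RellichScarSymmetricScarExistsLimitRepresentative
import Summits.NavierStokesRegularity.NavierStokesRegularity.Theorems.RellichScarSymmetricScarExistsSlabLimit
import Summits.NavierStokesRegularity.NavierStokesRegularity.Theorems.RellichScarSymmetricScarExistsScarDefectLimit
import Summits.NavierStokesRegularity.NavierStokesRegularity.Theorems.RellichScarSymmetricScarExistsScarDefectLimitLemmas
import Summits.NavierStokesRegularity.NavierStokesRegularity.Theorems.RellichScarSymmetricScarExistsRotWindowRigidity
import Summits.NavierStokesRegularity.NavierStokesRegularity.Theorems.RellichScarSymmetricScarExistsFlatSourceTransfer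
import Literature.Analysis.FluidPDE.LocalTypeI
import Literature.Analysis.FluidPDE.TypeIAncientMild

/-!
# Crux `SymmetricScarExists` (stmt-NavierStokesRegularity-11718), line `rdss-screw-split`:
# the FLAT SCREW SOURCE form of child A (RDSS scar selection)

Helper file of the line lead (`--supports stmt-NavierStokesRegularity-11718`; theorems only, no definitions, no
named facts).  The line `rdss-screw-split` decomposes the crux into A = RDSS scar selection (*if a singular apex
Type-I profile exists, one exists whose scar is fixed by ONE screw-dilation `R_θ ∘ D_c`, `c > 1`, or is
axisymmetric*), B = RDSS scar rigidity, C = RDSS apex Fatal.  This file gives child A its compactness-upgraded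
"flat source" form, the screw analogue of `flatSource_iff_symmetricScarExists`
(`Theorems/RellichScarSymmetricScarExistsFlatSourceTransfer.lean`):

* `screwDefectLimit` — the SCREW DEFECT passes to `L³_loc` limits of apex profiles: along an `L³(Q(0,R))`-convergent
  (every `R > 0`) sequence `w j → u` of apex profiles with one decay constant `C > 0`, eventual smallness of
  `‖R_θ D_c (w j) − w j‖_{L^∞((−δ,0)×K)}` (every compact `K ∌ 0`, all small `δ`) forces
  `SameScar (conjZ θ (nsRescale c u)) u`.  Same mechanism as `stub_scarDefectLimit` (classical representatives
  `stub_apexMildRepresentative`, scars with a uniform cubic rate `stub_apexScarTrace`, pointwise convergence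
  `stub_limitRepresentative`, the abstract engine `sameScar_of_flat_defect`), run for the COMPOSITE operation
  `T = conjZ θ ∘ nsRescale c` with `T' σ = R_θ (c σ(c R_{−θ} ·))`.
* `rdssScarSelection_of_flatScrewSource` — **flat screw source ⇒ A** (registered auxiliary stub): the source's
  sequence (decay constant bumped to `|C'| + 1 > 0`) subconverges to a singular apex profile (`stub_slabLimit`);
  in the screw branch `screwDefectLimit` at the one pair `(c, θ)` gives the first disjunct of A; in the rotation
  branch the rotation half of `stub_scarDefectLimit` on the window `[a, b]` and `stub_rotWindowRigidity` give an
  axisymmetric scar.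
* `flatScrewSource_of_rdssScarSelection` — **A ⇒ flat screw source** (the constant sequence).
* `flatScrewSource_iff_rdssScarSelection` — **the two are equivalent** (registered auxiliary stub): to prove A it
  suffices to produce a SEQUENCE of singular apex profiles (bounded `𝐈`, one Type-I constant) whose screw defect at
  one fixed `(c, θ)`, `c > 1`, tends to zero — the output shape of any recurrence / closing engine.

References: D. Albritton, T. Barker, J. Math. Fluid Mech. 21 (2019) = arXiv:1811.00502, Lemma 2.2, Prop. 2.3
[AlbrittonBarker2019]; G. Koch, N. Nadirashvili, G. Seregin, V. Šverák, Acta Math. 203 (2009), (1.6), §4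
[KNSS2009].
-/

noncomputable section

open MeasureTheory Set Function Filter Topology TopologicalSpace Metric
open scoped NNReal ENNReal

namespace Summit.NavierStokesRegularity.NavierStokesRegularity.Theorems.SymmetricScarExists.RdssSplit.FlatScrew

open Literature.Analysis.FluidPDE
open Summit.NavierStokesRegularity.NavierStokesRegularity.Theses.RellichScar
open Summit.NavierStokesRegularity.NavierStokesRegularity.Theorems.SymmetricScarExists.Negative
open Summit.NavierStokesRegularity.NavierStokesRegularity.Theorems.SymmetricScarExists.ScarWindow
open Summit.NavierStokesRegularity.NavierStokesRegularity.Theorems.ScarRigidity.Negative (hasTypeIDecay_mono)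

set_option linter.dupNamespace false

/-! ## §1 The screw defect passes to `L³_loc` limits -/

/-- **Screw defect limit.**  Along an `L³(Q(0,R))`-convergent (every `R > 0`) sequence of apex profiles `w j → u`
with one decay constant `C > 0`, smallness of the screw defect `R_θ D_c (w j) − w j` (`0 < c`) on every compact
`K ∌ 0` (essentially near the final slice, eventually along the sequence) passes to the limit as
`SameScar (conjZ θ (nsRescale c u)) u`.  Mechanism: classical representatives (`stub_apexMildRepresentative`),
scars with a uniform cubic rate (`stub_apexScarTrace`), pointwise convergence of the representatives
(`stub_limitRepresentative`) and of the scars (`tendsto_static_of_tendsto`), and the abstract defect-limit lemma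
`sameScar_of_flat_defect` for the composite operation `T = conjZ θ ∘ nsRescale c`,
`T' σ = R_θ (c σ(c R_{−θ} ·))` (continuity on the slab: `continuousOn_uncurry_conjZ ∘ continuousOn_uncurry_nsRescale`;
rate transport: `rate_conjZ ∘ rate_nsRescale`). [folklore] -/
theorem screwDefectLimit (C : ℝ) (w : ℕ → ℝ → EuclideanSpace ℝ (Fin 3) → EuclideanSpace ℝ (Fin 3))
    (qw : ℕ → ℝ → EuclideanSpace ℝ (Fin 3) → ℝ)
    (Hw : ℕ → ℝ → EuclideanSpace ℝ (Fin 3) → EuclideanSpace ℝ (Fin 3) →L[ℝ] EuclideanSpace ℝ (Fin 3))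
    (u : ℝ → EuclideanSpace ℝ (Fin 3) → EuclideanSpace ℝ (Fin 3)) (p : ℝ → EuclideanSpace ℝ (Fin 3) → ℝ)
    (G : ℝ → EuclideanSpace ℝ (Fin 3) → EuclideanSpace ℝ (Fin 3) →L[ℝ] EuclideanSpace ℝ (Fin 3))
    (hC : 0 < C)
    (hw : ∀ j : ℕ, IsSuitableWeakSolutionOn (slab (EuclideanSpace ℝ (Fin 3)) (Iio (0 : ℝ)) isOpen_Iio) 1 0 (w j) (qw j) ∧ HasWeakSpatialGradientOn (slab (EuclideanSpace ℝ (Fin 3)) (Iio (0 : ℝ)) isOpen_Iio) (w j) (Hw j) ∧ typeIBound (Iio (0 : ℝ) ×ˢ univ) (w j) (qw j) (Hw j) < ⊤ ∧ HasTypeIDecay C (w j))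
    (hsu : IsSuitableWeakSolutionOn (slab (EuclideanSpace ℝ (Fin 3)) (Iio (0 : ℝ)) isOpen_Iio) 1 0 u p)
    (hwg : HasWeakSpatialGradientOn (slab (EuclideanSpace ℝ (Fin 3)) (Iio (0 : ℝ)) isOpen_Iio) u G)
    (hIu : typeIBound (Iio (0 : ℝ) ×ˢ univ) u p G < ⊤) (hdu : HasTypeIDecay C u)
    (hconv : ∀ R : ℝ, 0 < R → Tendsto (fun j => eLpNorm (uncurry (w j) - uncurry u) 3 (volume.restrict (parabolicCylinder R (0 : ℝ × EuclideanSpace ℝ (Fin 3))))) atTop (𝓝 0))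
    {c : ℝ} (hc : 0 < c) (θ : ℝ)
    (Hflat : ∀ K : Set (EuclideanSpace ℝ (Fin 3)), IsCompact K → (0 : EuclideanSpace ℝ (Fin 3)) ∉ K → ∀ ε : ℝ, 0 < ε → ∀ᶠ j in atTop, ∀ᶠ δ in 𝓝[>] (0 : ℝ), eLpNorm (uncurry (conjZ θ (nsRescale c (w j))) - uncurry (w j)) ⊤ (volume.restrict (Ioo (-δ) 0 ×ˢ K)) ≤ ENNReal.ofReal ε) :
    SameScar (conjZ θ (nsRescale c u)) u := by
  -- Step 0: classical representatives (a.e. equal on the slab) and their scars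
  obtain ⟨L, hL, hB1C⟩ := stub_apexScarTrace C hC
  choose W hWae hWmild hWdec using fun j =>
    RellichScarScarRigidity.stub_apexMildRepresentative (w j) (qw j) (Hw j) C hC (hw j).1
      (hw j).2.1 (hw j).2.2.1 (hw j).2.2.2
  obtain ⟨U, hUae, hUmild, hUdec⟩ :=
    RellichScarScarRigidity.stub_apexMildRepresentative u p G C hC hsu hwg hIu hdu
  choose σ hσ using fun j => hB1C (W j) (hWmild j) (hWdec j)
  obtain ⟨σU, hUrate, -, -⟩ := hB1C U hUmild hUdec
  have hWcont : ∀ j, ContinuousOn (uncurry (W j))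
      (Iio (0 : ℝ) ×ˢ (univ : Set (EuclideanSpace ℝ (Fin 3)))) :=
    fun j => (hWmild j).1.continuousOn
  -- Step 1: `L³_loc` convergence of the representatives, pointwise convergence, of the scars
  have hconvW : ∀ R : ℝ, 0 < R → Tendsto (fun j => eLpNorm (uncurry (W j) - uncurry U) 3
      (volume.restrict (parabolicCylinder R (0 : ℝ × EuclideanSpace ℝ (Fin 3))))) atTop (𝓝 0) := by
    intro R hR
    refine (hconv R hR).congr fun j => eLpNorm_congr_ae ?_
    have hsub : parabolicCylinder R (0 : ℝ × EuclideanSpace ℝ (Fin 3)) ⊆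
        Iio (0 : ℝ) ×ˢ (univ : Set (EuclideanSpace ℝ (Fin 3))) :=
      parabolicCylinder_origin_subset_slab R
    have h1 : uncurry (W j)
        =ᵐ[volume.restrict (parabolicCylinder R (0 : ℝ × EuclideanSpace ℝ (Fin 3)))]
        uncurry (w j) := ae_restrict_of_ae_restrict_of_subset hsub (hWae j)
    have h2 : uncurry U
        =ᵐ[volume.restrict (parabolicCylinder R (0 : ℝ × EuclideanSpace ℝ (Fin 3)))]
        uncurry u := ae_restrict_of_ae_restrict_of_subset hsub hUae
    exact (h1.sub h2).symm
  have hpt : ∀ t < (0 : ℝ), ∀ x : EuclideanSpace ℝ (Fin 3),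
      Tendsto (fun j => W j t x) atTop (𝓝 (U t x)) :=
    stub_limitRepresentative C hC W U (fun j => ⟨hWmild j, hWdec j⟩) hUmild hUdec hconvW
  have hσlim : ∀ x : EuclideanSpace ℝ (Fin 3), x ≠ 0 →
      Tendsto (fun j => σ j x) atTop (𝓝 (σU x)) := fun x hx =>
    tendsto_static_of_tendsto (fun j => (hσ j).1) hUrate hpt hx
  -- Step 2: the screw case on the representatives, then back to `u`
  have hflat : ∀ K : Set (EuclideanSpace ℝ (Fin 3)), IsCompact K →
      (0 : EuclideanSpace ℝ (Fin 3)) ∉ K → ∀ ε : ℝ, 0 < ε → ∀ᶠ j in atTop,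
      ∀ᶠ δ in 𝓝[>] (0 : ℝ), eLpNorm (uncurry (conjZ θ (nsRescale c (W j))) - uncurry (W j)) ⊤
        (volume.restrict (Ioo (-δ) 0 ×ˢ K)) ≤ ENNReal.ofReal ε := by
    intro K hK h0 ε hε
    filter_upwards [Hflat K hK h0 ε hε] with j hj
    filter_upwards [hj] with δ hδ
    rwa [eLpNorm_scar_congr_ae (conjZ_ae_eq_slab θ (nsRescale_ae_eq_slab hc (hWae j).symm))
      (hWae j).symm] at hδ
  -- the composite operation transports the cubic trace rate (elaborated WITHOUT expected type:
  -- unifying the trace slot against `c • s (c • ·)` head-on makes the unifier unfold `rotZ`)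
  have hTrate : ∀ (V : ℝ → EuclideanSpace ℝ (Fin 3) → EuclideanSpace ℝ (Fin 3))
      (s : EuclideanSpace ℝ (Fin 3) → EuclideanSpace ℝ (Fin 3)),
      (∀ t : ℝ, t < 0 → ∀ x : EuclideanSpace ℝ (Fin 3), x ≠ 0 → ‖V t x - s x‖ ≤ L * (-t) / ‖x‖ ^ 3) →
      ∀ t : ℝ, t < 0 → ∀ x : EuclideanSpace ℝ (Fin 3), x ≠ 0 →
        ‖conjZ θ (nsRescale c V) t x - rotZ θ (c • s (c • rotZ (-θ) x))‖ ≤ L * (-t) / ‖x‖ ^ 3 := by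
    intro V s hVs
    have h := rate_conjZ θ (rate_nsRescale hc hVs)
    exact h
  have hS : SameScar (conjZ θ (nsRescale c U)) U :=
    sameScar_of_flat_defect (fun V => conjZ θ (nsRescale c V))
      (fun s x => rotZ θ (c • s (c • rotZ (-θ) x))) L W U σ σU hL
      (fun V hV => continuousOn_uncurry_conjZ θ (continuousOn_uncurry_nsRescale hc hV))
      hTrate
      (fun s sl hs x hx => ((rotZIso θ).continuous.tendsto _).comp
        ((hs (c • rotZ (-θ) x) (smul_ne_zero hc.ne' (rotZ_ne_zero (-θ) hx))).const_smul c))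
      hWcont (fun j => (hσ j).1) hUrate hσlim hflat
  exact (sameScar_congr_ae (conjZ_ae_eq_slab θ (nsRescale_ae_eq_slab hc hUae)) hUae).1 hS

/-! ## §2 Flat screw source ⇒ child A -/

/-- **Flat screw source ⇒ A** (registered auxiliary stub `rdssScarSelection_of_flatScrewSource` of the line
`rdss-screw-split`): if every singular apex profile spawns a SEQUENCE of singular apex profiles (bounded `𝐈`, one
Type-I constant) whose screw defect at one fixed `(c, θ)`, `c > 1`, tends to zero — or whose rotation defects on a
window of angles `[a, b]` tend to zero — then child A (RDSS scar selection) holds.  The sequence (decay constant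
bumped to `|C'| + 1 > 0`) subconverges to a singular apex profile (`stub_slabLimit`); along the subsequence the
defects still tend to zero, so the limit's scar is screw-invariant (`screwDefectLimit`), resp. rotation-flat on
the window (`stub_scarDefectLimit`) and hence axisymmetric (`stub_rotWindowRigidity`).
[cite: AlbrittonBarker2019, Lemma 2.2 and Prop. 2.3] -/
theorem rdssScarSelection_of_flatScrewSource :
    (∀ C : ℝ, (∃ (u : ℝ → EuclideanSpace ℝ (Fin 3) → EuclideanSpace ℝ (Fin 3)) (p : ℝ → EuclideanSpace ℝ (Fin 3) → ℝ) (G : ℝ → EuclideanSpace ℝ (Fin 3) → EuclideanSpace ℝ (Fin 3) →L[ℝ] EuclideanSpace ℝ (Fin 3)), IsSuitableWeakSolutionOn (slab (EuclideanSpace ℝ (Fin 3)) (Iio 0) isOpen_Iio) 1 0 u p ∧ HasWeakSpatialGradientOn (slab (EuclideanSpace ℝ (Fin 3)) (Iio 0) isOpen_Iio) u G ∧ typeIBound (Iio (0 : ℝ) ×ˢ univ) u p G < ⊤ ∧ HasTypeIDecay C u ∧ IsBackwardSingularPoint u 0) → ∃ (C' : ℝ) (I : ENNReal) (v : ℕ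 → ℝ → EuclideanSpace ℝ (Fin 3) → EuclideanSpace ℝ (Fin 3)) (q : ℕ → ℝ → EuclideanSpace ℝ (Fin 3) → ℝ) (H : ℕ → ℝ → EuclideanSpace ℝ (Fin 3) → EuclideanSpace ℝ (Fin 3) →L[ℝ] EuclideanSpace ℝ (Fin 3)), I < ⊤ ∧ (∀ k : ℕ, IsSuitableWeakSolutionOn (slab (EuclideanSpace ℝ (Fin 3)) (Iio 0) isOpen_Iio) 1 0 (v k) (q k) ∧ HasWeakSpatialGradientOn (slab (EuclideanSpace ℝ (Fin 3)) (Iio 0) isOpen_Iio) (v k) (H k) ∧ typeIBound (Iio (0 : ℝ) ×ˢ univ) (v k) (q k) (H k) ≤ I ∧ HasTypeIDecay C' (v k) ∧ IsBackwardSingularPoint (v k) 0) ∧ ((∃ c θ : ℝ, 1 < c ∧ ∀ K : Set (EuclideanSpace ℝ (Fin 3)), IsCompact K → (0 : EuclideanSpace ℝ (Fin 3)) ∉ K → ∀ ε : ℝ, 0 < ε → ∀ᶠ k in atTop, ∀ᶠ δ in nhdsWithin (0 : ℝ) (Ioi 0), eLpNorm (uncurry (fun t x => rotZ θ (nsRescale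 c (v k) t (rotZ (-θ) x))) - uncurry (v k)) ⊤ (volume.restrict (Ioo (-δ) 0 ×ˢ K)) ≤ ENNReal.ofReal ε) ∨ (∃ a b : ℝ, a < b ∧ ∀ θ ∈ Set.Icc a b, ∀ K : Set (EuclideanSpace ℝ (Fin 3)), IsCompact K → (0 : EuclideanSpace ℝ (Fin 3)) ∉ K → ∀ ε : ℝ, 0 < ε → ∀ᶠ k in atTop, ∀ᶠ δ in nhdsWithin (0 : ℝ) (Ioi 0), eLpNorm (uncurry (fun t x => rotZ θ (v k t (rotZ (-θ) x))) - uncurry (v k)) ⊤ (volume.restrict (Ioo (-δ) 0 ×ˢ K)) ≤ ENNReal.ofReal ε))) → ∀ C : ℝ, (∃ (u : ℝ → EuclideanSpace ℝ (Fin 3) → EuclideanSpace ℝ (Fin 3)) (p : ℝ → EuclideanSpace ℝ (Fin 3) → ℝ) (G : ℝ → EuclideanSpace ℝ (Fin 3) → EuclideanSpace ℝ (Fin 3) →L[ℝ] EuclideanSpace ℝ (Fin 3)), IsSuitableWeakSolutionOn (slab (EuclideanSpace ℝ (Fin 3)) (Iio 0) isOpen_Iio) 1 0 u p ∧ HasWeakSpatialGradientOn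 (slab (EuclideanSpace ℝ (Fin 3)) (Iio 0) isOpen_Iio) u G ∧ typeIBound (Iio (0 : ℝ) ×ˢ univ) u p G < ⊤ ∧ HasTypeIDecay C u ∧ IsBackwardSingularPoint u 0) → ∃ (C' : ℝ) (u : ℝ → EuclideanSpace ℝ (Fin 3) → EuclideanSpace ℝ (Fin 3)) (p : ℝ → EuclideanSpace ℝ (Fin 3) → ℝ) (G : ℝ → EuclideanSpace ℝ (Fin 3) → EuclideanSpace ℝ (Fin 3) →L[ℝ] EuclideanSpace ℝ (Fin 3)), IsSuitableWeakSolutionOn (slab (EuclideanSpace ℝ (Fin 3)) (Iio 0) isOpen_Iio) 1 0 u p ∧ HasWeakSpatialGradientOn (slab (EuclideanSpace ℝ (Fin 3)) (Iio 0) isOpen_Iio) u G ∧ typeIBound (Iio (0 : ℝ) ×ˢ univ) u p G < ⊤ ∧ HasTypeIDecay C' u ∧ IsBackwardSingularPoint u 0 ∧ ((∃ c θ : ℝ, 1 < c ∧ ∀ K : Set (EuclideanSpace ℝ (Fin 3)), IsCompact K → (0 : EuclideanSpace ℝ (Fin 3)) ∉ K → Tendsto (fun δ : ℝ => eLpNorm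 (uncurry (fun t x => rotZ θ (nsRescale c u t (rotZ (-θ) x))) - uncurry u) ⊤ (volume.restrict (Ioo (-δ) 0 ×ˢ K))) (nhdsWithin 0 (Ioi 0)) (nhds 0)) ∨ (∀ θ : ℝ, ∀ K : Set (EuclideanSpace ℝ (Fin 3)), IsCompact K → (0 : EuclideanSpace ℝ (Fin 3)) ∉ K → Tendsto (fun δ : ℝ => eLpNorm (uncurry (fun t x => rotZ θ (u t (rotZ (-θ) x))) - uncurry u) ⊤ (volume.restrict (Ioo (-δ) 0 ×ˢ K))) (nhdsWithin 0 (Ioi 0)) (nhds 0))) := by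
  intro hsrc C hex
  obtain ⟨C', I, v, q, H, hI, hfam, hflat⟩ := hsrc C hex
  -- bump the decay constant to a positive one
  set C₁ : ℝ := |C'| + 1 with hC₁
  have hC₁pos : 0 < C₁ := by positivity
  have hCC : C' ≤ C₁ := (le_abs_self C').trans (by linarith)
  have hfam₁ : ∀ k : ℕ, IsSuitableWeakSolutionOn (slab (EuclideanSpace ℝ (Fin 3)) (Iio (0 : ℝ)) isOpen_Iio) 1 0 (v k) (q k) ∧ HasWeakSpatialGradientOn (slab (EuclideanSpace ℝ (Fin 3)) (Iio (0 : ℝ)) isOpen_Iio) (v k) (H k) ∧ typeIBound (Iio (0 : ℝ) ×ˢ univ) (v k) (q k) (H k) ≤ I ∧ HasTypeIDecay C₁ (v k) ∧ IsBackwardSingularPoint (v k) 0 :=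
    fun k => ⟨(hfam k).1, (hfam k).2.1, (hfam k).2.2.1, hasTypeIDecay_mono hCC (hfam k).2.2.2.1, (hfam k).2.2.2.2⟩
  -- compactness: a singular apex limit along a subsequence
  obtain ⟨u, p, G, φ, hφ, hsu, hwg, hIu, hdu, hsing, hconv⟩ := stub_slabLimit C₁ I v q H hC₁pos.le hI hfam₁
  -- the subsequence, still in the class, still converging
  have hw : ∀ j : ℕ, IsSuitableWeakSolutionOn (slab (EuclideanSpace ℝ (Fin 3)) (Iio (0 : ℝ)) isOpen_Iio) 1 0 (v (φ j)) (q (φ j)) ∧ HasWeakSpatialGradientOn (slab (EuclideanSpace ℝ (Fin 3)) (Iio (0 : ℝ)) isOpen_Iio) (v (φ j)) (H (φ j)) ∧ typeIBound (Iio (0 : ℝ) ×ˢ univ) (v (φ j)) (q (φ j)) (H (φ j)) < ⊤ ∧ HasTypeIDecay C₁ (v (φ j)) :=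
    fun j => ⟨(hfam₁ (φ j)).1, (hfam₁ (φ j)).2.1, lt_of_le_of_lt (hfam₁ (φ j)).2.2.1 hI, (hfam₁ (φ j)).2.2.2.1⟩
  refine ⟨C₁, u, p, G, hsu, hwg, hIu, hdu, hsing, ?_⟩
  rcases hflat with ⟨c, θ, hc1, hwin⟩ | ⟨a, b, hab, hwin⟩
  · -- screw-flat at `(c, θ)` ⇒ screw-invariant scar
    left
    refine ⟨c, θ, hc1, ?_⟩
    have hS : SameScar (conjZ θ (nsRescale c u)) u :=
      screwDefectLimit C₁ (fun j => v (φ j)) (fun j => q (φ j)) (fun j => H (φ j)) u p G hC₁pos hw hsu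
        hwg hIu hdu hconv (one_pos.trans hc1) θ fun K hK h0 ε hε =>
          eventually_comp_of_strictMono' hφ (hwin K hK h0 ε hε)
    exact hS
  · -- rotation-flat window ⇒ axisymmetric scar
    right
    obtain ⟨-, hrot⟩ := stub_scarDefectLimit stub_apexScarTrace stub_limitRepresentative C₁
      (fun j => v (φ j)) (fun j => q (φ j)) (fun j => H (φ j)) u p G hC₁pos hw hsu hwg hIu hdu hconv
    have hA : AxiScar u := by
      refine stub_rotWindowRigidity u a b hab fun θ hθ => ?_
      refine hrot θ fun K hK h0 ε hε => ?_
      exact eventually_comp_of_strictMono' hφ (hwin θ hθ K hK h0 ε hε)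
    exact hA

/-! ## §3 Child A ⇒ flat screw source, and the equivalence -/

/-- **A ⇒ flat screw source**: a singular apex profile with a screw-invariant, resp. axisymmetric, scar furnishes
the constant sequence, flat at the pair `(c, θ)`, resp. at every angle of the window `[1, 2]`, with `I` its own
`𝐈`. [folklore] -/
theorem flatScrewSource_of_rdssScarSelection
    (hA : ∀ C : ℝ, (∃ (u : ℝ → EuclideanSpace ℝ (Fin 3) → EuclideanSpace ℝ (Fin 3)) (p : ℝ → EuclideanSpace ℝ (Fin 3) → ℝ) (G : ℝ → EuclideanSpace ℝ (Fin 3) → EuclideanSpace ℝ (Fin 3) →L[ℝ] EuclideanSpace ℝ (Fin 3)), IsSuitableWeakSolutionOn (slab (EuclideanSpace ℝ (Fin 3)) (Iio 0) isOpen_Iio) 1 0 u p ∧ HasWeakSpatialGradientOn (slab (EuclideanSpace ℝ (Fin 3)) (Iio 0) isOpen_Iio) u G ∧ typeIBound (Iio (0 : ℝ) ×ˢ univ) u p G < ⊤ ∧ HasTypeIDecay C u ∧ IsBackwardSingularPoint u 0) → ∃ (C' : ℝ) (u : ℝ → EuclideanSpace ℝ (Fin 3) → EuclideanSpace ℝ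 (Fin 3)) (p : ℝ → EuclideanSpace ℝ (Fin 3) → ℝ) (G : ℝ → EuclideanSpace ℝ (Fin 3) → EuclideanSpace ℝ (Fin 3) →L[ℝ] EuclideanSpace ℝ (Fin 3)), IsSuitableWeakSolutionOn (slab (EuclideanSpace ℝ (Fin 3)) (Iio 0) isOpen_Iio) 1 0 u p ∧ HasWeakSpatialGradientOn (slab (EuclideanSpace ℝ (Fin 3)) (Iio 0) isOpen_Iio) u G ∧ typeIBound (Iio (0 : ℝ) ×ˢ univ) u p G < ⊤ ∧ HasTypeIDecay C' u ∧ IsBackwardSingularPoint u 0 ∧ ((∃ c θ : ℝ, 1 < c ∧ ∀ K : Set (EuclideanSpace ℝ (Fin 3)), IsCompact K → (0 : EuclideanSpace ℝ (Fin 3)) ∉ K → Tendsto (fun δ : ℝ => eLpNorm (uncurry (fun t x => rotZ θ (nsRescale c u t (rotZ (-θ) x))) - uncurry u) ⊤ (volume.restrict (Ioo (-δ) 0 ×ˢ K))) (nhdsWithin 0 (Ioi 0)) (nhds 0)) ∨ (∀ θ : ℝ, ∀ K : Set (EuclideanSpace ℝ (Fin 3)), IsCompact K → (0 : EuclideanSpace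 ℝ (Fin 3)) ∉ K → Tendsto (fun δ : ℝ => eLpNorm (uncurry (fun t x => rotZ θ (u t (rotZ (-θ) x))) - uncurry u) ⊤ (volume.restrict (Ioo (-δ) 0 ×ˢ K))) (nhdsWithin 0 (Ioi 0)) (nhds 0)))) :
    ∀ C : ℝ, (∃ (u : ℝ → EuclideanSpace ℝ (Fin 3) → EuclideanSpace ℝ (Fin 3)) (p : ℝ → EuclideanSpace ℝ (Fin 3) → ℝ) (G : ℝ → EuclideanSpace ℝ (Fin 3) → EuclideanSpace ℝ (Fin 3) →L[ℝ] EuclideanSpace ℝ (Fin 3)), IsSuitableWeakSolutionOn (slab (EuclideanSpace ℝ (Fin 3)) (Iio 0) isOpen_Iio) 1 0 u p ∧ HasWeakSpatialGradientOn (slab (EuclideanSpace ℝ (Fin 3)) (Iio 0) isOpen_Iio) u G ∧ typeIBound (Iio (0 : ℝ) ×ˢ univ) u p G < ⊤ ∧ HasTypeIDecay C u ∧ IsBackwardSingularPoint u 0) → ∃ (C' : ℝ) (I : ENNReal) (v : ℕ → ℝ → EuclideanSpace ℝ (Fin 3) → EuclideanSpace ℝ (Fin 3)) (q : ℕ → ℝ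 → EuclideanSpace ℝ (Fin 3) → ℝ) (H : ℕ → ℝ → EuclideanSpace ℝ (Fin 3) → EuclideanSpace ℝ (Fin 3) →L[ℝ] EuclideanSpace ℝ (Fin 3)), I < ⊤ ∧ (∀ k : ℕ, IsSuitableWeakSolutionOn (slab (EuclideanSpace ℝ (Fin 3)) (Iio 0) isOpen_Iio) 1 0 (v k) (q k) ∧ HasWeakSpatialGradientOn (slab (EuclideanSpace ℝ (Fin 3)) (Iio 0) isOpen_Iio) (v k) (H k) ∧ typeIBound (Iio (0 : ℝ) ×ˢ univ) (v k) (q k) (H k) ≤ I ∧ HasTypeIDecay C' (v k) ∧ IsBackwardSingularPoint (v k) 0) ∧ ((∃ c θ : ℝ, 1 < c ∧ ∀ K : Set (EuclideanSpace ℝ (Fin 3)), IsCompact K → (0 : EuclideanSpace ℝ (Fin 3)) ∉ K → ∀ ε : ℝ, 0 < ε → ∀ᶠ k in atTop, ∀ᶠ δ in nhdsWithin (0 : ℝ) (Ioi 0), eLpNorm (uncurry (fun t x => rotZ θ (nsRescale c (v k) t (rotZ (-θ) x))) - uncurry (v k)) ⊤ (volume.restrict (Ioo (-δ) 0 ×ˢ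 K)) ≤ ENNReal.ofReal ε) ∨ (∃ a b : ℝ, a < b ∧ ∀ θ ∈ Set.Icc a b, ∀ K : Set (EuclideanSpace ℝ (Fin 3)), IsCompact K → (0 : EuclideanSpace ℝ (Fin 3)) ∉ K → ∀ ε : ℝ, 0 < ε → ∀ᶠ k in atTop, ∀ᶠ δ in nhdsWithin (0 : ℝ) (Ioi 0), eLpNorm (uncurry (fun t x => rotZ θ (v k t (rotZ (-θ) x))) - uncurry (v k)) ⊤ (volume.restrict (Ioo (-δ) 0 ×ˢ K)) ≤ ENNReal.ofReal ε)) := by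
  intro C hex
  obtain ⟨C', u, p, G, hsu, hwg, hIu, hdu, hsing, hsym⟩ := hA C hex
  refine ⟨C', typeIBound (Iio (0 : ℝ) ×ˢ univ) u p G, fun _ => u, fun _ => p, fun _ => G, hIu,
    fun _ => ⟨hsu, hwg, le_rfl, hdu, hsing⟩, ?_⟩
  rcases hsym with ⟨c, θ, hc1, hscrew⟩ | hax
  · refine Or.inl ⟨c, θ, hc1, fun K hK h0 ε hε => Eventually.of_forall fun _ => ?_⟩
    exact eventually_le_ofReal_of_tendsto_zero (hscrew K hK h0) hε
  · refine Or.inr ⟨1, 2, by norm_num, fun θ _ K hK h0 ε hε => Eventually.of_forall fun _ => ?_⟩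
    exact eventually_le_ofReal_of_tendsto_zero (hax θ K hK h0) hε

/-- **The flat screw source is an equivalent form of child A** (registered auxiliary stub
`flatScrewSource_iff_rdssScarSelection` of the line `rdss-screw-split`): RDSS scar selection holds iff every
singular apex profile spawns a sequence of singular apex profiles (bounded `𝐈`, one Type-I constant) with
asymptotically screw-flat scars at one pair `(c, θ)`, `c > 1` (or rotation-flat scars on a window of angles).  The
non-trivial direction is the compactness upgrade `rdssScarSelection_of_flatScrewSource`.
[cite: AlbrittonBarker2019, Lemma 2.2 and Prop. 2.3] -/
theorem flatScrewSource_iff_rdssScarSelection :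
    (∀ C : ℝ, (∃ (u : ℝ → EuclideanSpace ℝ (Fin 3) → EuclideanSpace ℝ (Fin 3)) (p : ℝ → EuclideanSpace ℝ (Fin 3) → ℝ) (G : ℝ → EuclideanSpace ℝ (Fin 3) → EuclideanSpace ℝ (Fin 3) →L[ℝ] EuclideanSpace ℝ (Fin 3)), IsSuitableWeakSolutionOn (slab (EuclideanSpace ℝ (Fin 3)) (Iio 0) isOpen_Iio) 1 0 u p ∧ HasWeakSpatialGradientOn (slab (EuclideanSpace ℝ (Fin 3)) (Iio 0) isOpen_Iio) u G ∧ typeIBound (Iio (0 : ℝ) ×ˢ univ) u p G < ⊤ ∧ HasTypeIDecay C u ∧ IsBackwardSingularPoint u 0) → ∃ (C' : ℝ) (I : ENNReal) (v : ℕ → ℝ → EuclideanSpace ℝ (Fin 3) → EuclideanSpace ℝ (Fin 3)) (q : ℕ → ℝ → EuclideanSpace ℝ (Fin 3) → ℝ) (H : ℕ → ℝ → EuclideanSpace ℝ (Fin 3) → EuclideanSpace ℝ (Fin 3) →L[ℝ] EuclideanSpace ℝ (Fin 3)), I < ⊤ ∧ (∀ k : ℕ, IsSuitableWeakSolutionOn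 (slab (EuclideanSpace ℝ (Fin 3)) (Iio 0) isOpen_Iio) 1 0 (v k) (q k) ∧ HasWeakSpatialGradientOn (slab (EuclideanSpace ℝ (Fin 3)) (Iio 0) isOpen_Iio) (v k) (H k) ∧ typeIBound (Iio (0 : ℝ) ×ˢ univ) (v k) (q k) (H k) ≤ I ∧ HasTypeIDecay C' (v k) ∧ IsBackwardSingularPoint (v k) 0) ∧ ((∃ c θ : ℝ, 1 < c ∧ ∀ K : Set (EuclideanSpace ℝ (Fin 3)), IsCompact K → (0 : EuclideanSpace ℝ (Fin 3)) ∉ K → ∀ ε : ℝ, 0 < ε → ∀ᶠ k in atTop, ∀ᶠ δ in nhdsWithin (0 : ℝ) (Ioi 0), eLpNorm (uncurry (fun t x => rotZ θ (nsRescale c (v k) t (rotZ (-θ) x))) - uncurry (v k)) ⊤ (volume.restrict (Ioo (-δ) 0 ×ˢ K)) ≤ ENNReal.ofReal ε) ∨ (∃ a b : ℝ, a < b ∧ ∀ θ ∈ Set.Icc a b, ∀ K : Set (EuclideanSpace ℝ (Fin 3)), IsCompact K → (0 : EuclideanSpace ℝ (Fin 3)) ∉ K → ∀ ε : ℝ,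 0 < ε → ∀ᶠ k in atTop, ∀ᶠ δ in nhdsWithin (0 : ℝ) (Ioi 0), eLpNorm (uncurry (fun t x => rotZ θ (v k t (rotZ (-θ) x))) - uncurry (v k)) ⊤ (volume.restrict (Ioo (-δ) 0 ×ˢ K)) ≤ ENNReal.ofReal ε))) ↔ (∀ C : ℝ, (∃ (u : ℝ → EuclideanSpace ℝ (Fin 3) → EuclideanSpace ℝ (Fin 3)) (p : ℝ → EuclideanSpace ℝ (Fin 3) → ℝ) (G : ℝ → EuclideanSpace ℝ (Fin 3) → EuclideanSpace ℝ (Fin 3) →L[ℝ] EuclideanSpace ℝ (Fin 3)), IsSuitableWeakSolutionOn (slab (EuclideanSpace ℝ (Fin 3)) (Iio 0) isOpen_Iio) 1 0 u p ∧ HasWeakSpatialGradientOn (slab (EuclideanSpace ℝ (Fin 3)) (Iio 0) isOpen_Iio) u G ∧ typeIBound (Iio (0 : ℝ) ×ˢ univ) u p G < ⊤ ∧ HasTypeIDecay C u ∧ IsBackwardSingularPoint u 0) → ∃ (C' : ℝ) (u : ℝ → EuclideanSpace ℝ (Fin 3) → EuclideanSpace ℝ (Fin 3)) (p : ℝ →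 EuclideanSpace ℝ (Fin 3) → ℝ) (G : ℝ → EuclideanSpace ℝ (Fin 3) → EuclideanSpace ℝ (Fin 3) →L[ℝ] EuclideanSpace ℝ (Fin 3)), IsSuitableWeakSolutionOn (slab (EuclideanSpace ℝ (Fin 3)) (Iio 0) isOpen_Iio) 1 0 u p ∧ HasWeakSpatialGradientOn (slab (EuclideanSpace ℝ (Fin 3)) (Iio 0) isOpen_Iio) u G ∧ typeIBound (Iio (0 : ℝ) ×ˢ univ) u p G < ⊤ ∧ HasTypeIDecay C' u ∧ IsBackwardSingularPoint u 0 ∧ ((∃ c θ : ℝ, 1 < c ∧ ∀ K : Set (EuclideanSpace ℝ (Fin 3)), IsCompact K → (0 : EuclideanSpace ℝ (Fin 3)) ∉ K → Tendsto (fun δ : ℝ => eLpNorm (uncurry (fun t x => rotZ θ (nsRescale c u t (rotZ (-θ) x))) - uncurry u) ⊤ (volume.restrict (Ioo (-δ) 0 ×ˢ K))) (nhdsWithin 0 (Ioi 0)) (nhds 0)) ∨ (∀ θ : ℝ, ∀ K : Set (EuclideanSpace ℝ (Fin 3)), IsCompact K → (0 : EuclideanSpace ℝ (Fin 3)) ∉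 K → Tendsto (fun δ : ℝ => eLpNorm (uncurry (fun t x => rotZ θ (u t (rotZ (-θ) x))) - uncurry u) ⊤ (volume.restrict (Ioo (-δ) 0 ×ˢ K))) (nhdsWithin 0 (Ioi 0)) (nhds 0)))) :=
  ⟨rdssScarSelection_of_flatScrewSource, flatScrewSource_of_rdssScarSelection⟩

end Summit.NavierStokesRegularity.NavierStokesRegularity.Theorems.SymmetricScarExists.RdssSplit.FlatScrew

end
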